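import Summits.QuantumFields.YangMills.Theorems.FluctuationComparisonRegPrIntLS2BetaDiscrepancyIntraBlock
import HarnessLib

/-!
# S2β · Q11h — THE FACE LADDER: ACROSS A BLOCK FACE THE CHORD OF A FACE-CROSSING BOND DIFFERS FROM THE CENTRAL ONE BY AT MOST `(Σ_{ν≠μ}|(x − c)_ν|)·(1 + 2·((L−1)∕2))·ρ`
# (any torus in standing range, any `GaugeGroup`; two configurations agreeing on the tree-comb bonds of the block and of its neighbour — the off-centre face input of the c₃ row)

Cell `ym3-torus` (rung R3 = continuum `SU(2)` YM₃ on T³ at fixed lattice data — NOT d = 4, NOT infinite volume, NOT a mass gap, NOT Clay).  Width seat `ym3-torus-px5` (gen 23);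
crux `stmt-QuantumFields-20520`, LINE g18-1 S2β; the one-profile LIFT-LADDER″ row (architect RULINGS (i)(ii) 19:24:49Z, (1)–(3) 19:37:59Z): its face source `sF` (✓p833084 `hface`) is px20 g24's
CENTRAL-bond letter ⧗`…CentralFaceDiscrepancy.dist1_centralDisc_le_stage` at `b0 c` PLUS «Q11 ladders for off-centre faces» (RULING (i)) — THIS FILE.  Setting (abstract, as Q11b-lattice ✓p831150):
two level-`j` configurations `W, U` that AGREE on every tree-comb bond of the block `B` AND of its neighbour `B + e_μ` (for the pair `(W_t, W̃ := A_W·A_U⁻¹·U_t)` this is (T4), ✓p832282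
`tilde_agree_of_treeComb`), and whose relative plaquettes with source in `B` or `B + e_μ` have `dist1 ≤ ρ`.  The face-crossing bonds `⟨x, μ⟩`, `x` on the `μ`-face layer of `B`
(`(x − emb B)_μ = (L−1)∕2`), are the RUNGS of a ladder across the face; one transverse step is Q11a′ ✓p830038 (`dist1_farRung_rel_le`∕`dist1_nearRung_rel_le`): a relative plaquette
(`≤ ρ`) + the two RAILS `⟨x′, ν⟩ ⊂ B` and `⟨x′ + e_μ, ν⟩ ⊂ B + e_μ`, intra-block bonds priced by Q11b-lattice's coordinate ladder (`≤ ((L−1)∕2)·ρ` each: along the lowest-direction walk only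
the `μ`-coordinate is nonzero below `ν`).  Hence (§2, induction on `Σ_{ν≠μ}|(x − emb B)_ν|`): **`dist1 (U⟨x,μ⟩⁻¹·W⟨x,μ⟩) ≤ dist1 (U⟨x₀,μ⟩⁻¹·W⟨x₀,μ⟩) + (Σ_{ν≠μ}|(x − emb B)_ν|)·(1 + 2·((L−1)∕2))·ρ`**,
`x₀ = emb B + ((L−1)∕2)·e_μ` the face centre (= px17∕px20's `(b0 c).src`), so `≤ central + (d−1)·((L−1)∕2)·L·ρ` (`6ρ` at d = 3, L = 3).  `--kind proof --supports stmt-QuantumFields-20520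
--as helper`, count-neutral, DEFINITION-FREE (0 `def`, 0 `instance`, 0 `notation`, 0 `sorry`, default heartbeats); generic `P : Params` (standing range), ANY `GaugeGroup G`.

WHAT IS PROVED (sorry-free).
* §1 `transl_emb_shift` (coordinates w.r.t. the neighbour block), `exists_min_dir'`, `sum_lower_le_of_transverse_zero`, `dist1_mul_conj_le'`, `dist1_inv_mul_eq_dist1_inv_mul`.
* §2 ★★★`dist1_faceChord_transl_le` (coordinate form), ★★★`dist1_faceChord_le_central_add` (block form: `blockOf x = B`, `blockOf (x+μ) ≠ B`… stated via the face-layer coordinate).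

HONEST SCOPE.  Lattice∕group bookkeeping over landed lemmas; nothing of Bałaban's analysis is asserted or proved; the CENTRAL bond's letter (px20), `ρ̃`'s bound (px12 (d)), the tower
instantiation∕`SU(2)` arc edition (one `exact` over ✓p832282∕✓p832614's pattern — next file if wanted), READ′ aggregation and budgets are NOT here; rows∕letters HYPOTHESES; GAP♯∘
(`stub_uniformFibreGapOrbit`, registry 3732b7df UNTOUCHED, 0∕5), S2β, the five registered stubs, 20520, 19936, 19200, `YM3TorusSU2` NOT proved; no summit statement is proved by a helper;
rung R3 — NOT d = 4, NOT infinite volume, NOT a mass gap, NOT Clay; the Yang–Mills mass gap is NOT proved.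

References: T. Bałaban, CMP **122** (1989) 355–392 [Balaban1989LargeFieldII] (p.382); CMP **98** (1985) 17–51 [Balaban1985Averaging] ((19) p.21, p.24); CMP **109** (1987) 249–301
[Balaban1987RG1] ((0.3)–(0.4) p.252).
-/

set_option autoImplicit false

namespace Summit.QuantumFields.YangMills.Theorems.FluctuationComparisonRegPrIntLS2BetaFaceLadderDiscrepancy

open Literature.MathematicalPhysics.QuantumFieldTheory.Balaban1983to89
open Literature.MathematicalPhysics.QuantumFieldTheory.Balaban1983to89.T4Continuum
open Literature.MathematicalPhysics.QuantumFieldTheory.Balaban1983to89.BlockAveraging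
open B10Eq27TorusAxialLog (transl rel transl_apply transl_add_e transl_rel rel_shift_of_le)
open B7Prop1Explicit (e e_apply)
open Summit.QuantumFields.YangMills.Theorems.FluctuationComparisonRegPrIntLS2BetaRelativeStokes (dist1_mul_inv_eq_rel)
open Summit.QuantumFields.YangMills.Theorems.FluctuationComparisonRegPrIntLS2BetaRelativeLadderHolonomy (dist1_square_rel_le)
open Summit.QuantumFields.YangMills.Theorems.FluctuationComparisonRegPrIntLS2BetaRelativeLadderStep (dist1_farRung_rel_le dist1_nearRung_rel_le)
open Summit.QuantumFields.YangMills.Theorems.FluctuationComparisonRegPrIntLS2BetaTopLadderIntraBlock (blockOf_transl_emb rel_emb_transl coord_add_e coord_sub_e dist1_chord_transl_le)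

variable {P : Params} {j : ℕ} {G : Type*} [GaugeGroup G]

/-! ## §1 Bookkeeping -/

/-- Coordinates with respect to the neighbour block: `emb (B + e_μ) + z = emb B + (z + L·e_μ)`. [cite: Balaban1987RG1, (0.3) p.252] -/
theorem transl_emb_shift (B : Site P (j + 1)) (μ : Fin P.d) (z : B7Prop1Explicit.Site P.d) :
    transl (emb (B.shift μ)) z = transl (emb B) (z + (P.L : ℤ) • e μ) := by
  funext ν
  rw [transl_apply, transl_apply, emb_shift_apply, Pi.add_apply, Pi.smul_apply, e_apply, smul_eq_mul]
  by_cases h : ν = μ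
  · rw [if_pos h, if_pos h]; push_cast; ring
  · rw [if_neg h, if_neg h]; push_cast; ring

/-- The lowest direction carrying a nonzero coordinate. [folklore] -/
theorem exists_min_dir' (u : B7Prop1Explicit.Site P.d) (h : ∃ ν, u ν ≠ 0) : ∃ ν, u ν ≠ 0 ∧ ∀ ν', ν' < ν → u ν' = 0 := by
  classical
  set s : Finset (Fin P.d) := Finset.univ.filter (fun ν => u ν ≠ 0) with hs
  have hne : s.Nonempty := by
    obtain ⟨ν, hν⟩ := h
    exact ⟨ν, by simp only [hs, Finset.mem_filter, Finset.mem_univ, true_and]; exact hν⟩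
  have hmem := Finset.min'_mem s hne
  simp only [hs, Finset.mem_filter, Finset.mem_univ, true_and] at hmem
  refine ⟨s.min' hne, hmem, fun ν' hν' => ?_⟩
  by_contra hu
  have hν's : ν' ∈ s := by simp only [hs, Finset.mem_filter, Finset.mem_univ, true_and]; exact hu
  exact absurd (Finset.min'_le s ν' hν's) (not_le.mpr hν')

/-- Along the lowest-direction walk across the face only the `μ`-coordinate can be nonzero below `ν`: `Σ_{ν'<ν} |w_{ν'}| ≤ |w_μ|`. [folklore] -/
theorem sum_lower_le_of_transverse_zero (w : B7Prop1Explicit.Site P.d) (μ ν : Fin P.d) (hz : ∀ ν', ν' < ν → ν' ≠ μ → w ν' = 0) :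
    (∑ ν' ∈ Finset.univ.filter (fun ν' => ν' < ν), (w ν').natAbs) ≤ (w μ).natAbs := by
  classical
  calc (∑ ν' ∈ Finset.univ.filter (fun ν' => ν' < ν), (w ν').natAbs)
      = ∑ ν' ∈ Finset.univ.filter (fun ν' => ν' < ν), (if μ = ν' then (w ν').natAbs else 0) := by
        refine Finset.sum_congr rfl (fun ν' hν' => ?_)
        simp only [Finset.mem_filter, Finset.mem_univ, true_and] at hν'
        by_cases h : μ = ν'
        · rw [if_pos h]
        · rw [if_neg h, hz ν' hν' (fun h' => h h'.symm), Int.natAbs_zero]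
    _ = if μ ∈ Finset.univ.filter (fun ν' => ν' < ν) then (w μ).natAbs else 0 := Finset.sum_ite_eq _ _ _
    _ ≤ (w μ).natAbs := by split_ifs <;> omega

/-- `dist1 (X·(T⁻¹·Y·T)) ≤ dist1 X + dist1 Y`. [folklore] -/
theorem dist1_mul_conj_le' (X T Y : G) : dist1 (X * (T⁻¹ * Y * T)) ≤ dist1 X + dist1 Y := by
  refine (GaugeGroup.dist1_mul_le _ _).trans ?_
  have h : T⁻¹ * Y * T = T⁻¹ * Y * T⁻¹⁻¹ := by rw [inv_inv]
  rw [h, GaugeGroup.dist1_conj]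

/-- `dist1 (W⁻¹·U) = dist1 (U⁻¹·W)`. [folklore] -/
theorem dist1_inv_mul_eq_dist1_inv_mul (a b : G) : dist1 (a⁻¹ * b) = dist1 (b⁻¹ * a) := by
  rw [← GaugeGroup.dist1_inv (a⁻¹ * b), mul_inv_rev, inv_inv]

/-! ## §2 The face ladder -/

/-- ★★★ **THE FACE LADDER, COORDINATE FORM.**  `W = U` on the tree-comb bonds of `B` and of `B + e_μ`, relative plaquettes `≤ ρ` on both blocks ⟹ for `v` with `|v|_∞ ≤ (L−1)∕2`, `v_μ = (L−1)∕2`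
and `Σ_{ν≠μ}|v_ν| = n`: `dist1 (U⟨emb B + v, μ⟩⁻¹·W⟨emb B + v, μ⟩) ≤ dist1 (U⟨x₀,μ⟩⁻¹·W⟨x₀,μ⟩) + n·(1 + 2·((L−1)∕2))·ρ`, `x₀ = emb B + ((L−1)∕2)·e_μ`.
[cite: Balaban1989LargeFieldII, p.382; Balaban1985Averaging, (19) p.21; Balaban1987RG1, (0.3)-(0.4) p.252] -/
theorem dist1_faceChord_transl_le (hj : j + 1 ≤ P.m + P.K) (W U : GaugeField P j G) (B : Site P (j + 1)) (μ : Fin P.d)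
    (htree : ∀ (x : Site P j) (κ : Fin P.d), blockOf x = B → blockOf (x.shift κ) = B → (∀ ν, ν < κ → rel (emb B) x ν = 0) → W ⟨x, κ⟩ = U ⟨x, κ⟩)
    (htree' : ∀ (x : Site P j) (κ : Fin P.d), blockOf x = B.shift μ → blockOf (x.shift κ) = B.shift μ →
      (∀ ν, ν < κ → rel (emb (B.shift μ)) x ν = 0) → W ⟨x, κ⟩ = U ⟨x, κ⟩)
    {ρ : ℝ} (hρ0 : 0 ≤ ρ) (hρ : ∀ q : Plaq P j, blockOf q.src = B → dist1 ((GaugeField.plaqHol U q)⁻¹ * GaugeField.plaqHol W q) ≤ ρ)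
    (hρ' : ∀ q : Plaq P j, blockOf q.src = B.shift μ → dist1 ((GaugeField.plaqHol U q)⁻¹ * GaugeField.plaqHol W q) ≤ ρ) :
    ∀ (n : ℕ) (v : B7Prop1Explicit.Site P.d), (∀ ν, (v ν).natAbs ≤ (P.L - 1) / 2) → v μ = (((P.L - 1) / 2 : ℕ) : ℤ) →
      (∑ ν ∈ Finset.univ.filter (fun ν => ν ≠ μ), (v ν).natAbs) = n →
        dist1 ((U ⟨transl (emb B) v, μ⟩)⁻¹ * W ⟨transl (emb B) v, μ⟩) ≤
          dist1 ((U ⟨transl (emb B) (fun ν => if ν = μ then (((P.L - 1) / 2 : ℕ) : ℤ) else 0), μ⟩)⁻¹ *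
              W ⟨transl (emb B) (fun ν => if ν = μ then (((P.L - 1) / 2 : ℕ) : ℤ) else 0), μ⟩) +
            n * ((1 + 2 * (((P.L - 1) / 2 : ℕ) : ℝ)) * ρ) := by
  set h : ℕ := (P.L - 1) / 2 with hh
  have hL := AveragingRT.two_mul_half_add_one P
  have hshift : ∀ (v : B7Prop1Explicit.Site P.d) (κ : Fin P.d), (transl (emb B) v).shift κ = transl (emb B) (v + e κ) :=
    fun v κ => (transl_add_e (emb B) v κ).symm
  have hin : ∀ v : B7Prop1Explicit.Site P.d, (∀ ν, (v ν).natAbs ≤ h) → blockOf (transl (emb B) v) = B :=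
    fun v hv => blockOf_transl_emb hj B v hv
  -- the far side of a face bond: coordinates w.r.t. `B + e_μ`
  have hfar : ∀ v : B7Prop1Explicit.Site P.d, v μ = (h : ℤ) →
      transl (emb B) (v + e μ) = transl (emb (B.shift μ)) (v + e μ - (P.L : ℤ) • e μ) := by
    intro v _
    rw [transl_emb_shift, sub_add_cancel]
  have hfarb : ∀ v : B7Prop1Explicit.Site P.d, (∀ ν, (v ν).natAbs ≤ h) → v μ = (h : ℤ) →
      ∀ ν, ((v + e μ - (P.L : ℤ) • e μ) ν).natAbs ≤ h := by
    intro v hv hvμ ν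
    by_cases hν : ν = μ
    · have hval : (v + e μ - (P.L : ℤ) • e μ) ν = -(h : ℤ) := by
        have h1 : (v + e μ - (P.L : ℤ) • e μ) ν = v ν + 1 - (P.L : ℤ) := by
          simp only [Pi.sub_apply, Pi.add_apply, Pi.smul_apply, e_apply, hν, ite_true, smul_eq_mul, mul_one]
        rw [h1, hν, hvμ]; omega
      rw [hval, Int.natAbs_neg, Int.natAbs_natCast]
    · have hval : (v + e μ - (P.L : ℤ) • e μ) ν = v ν := by
        simp only [Pi.sub_apply, Pi.add_apply, Pi.smul_apply, e_apply, hν, ite_false, smul_eq_mul, mul_zero, add_zero, sub_zero]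
      rw [hval]; exact hv ν
  -- one RAIL in `B`: an intra-block bond `⟨transl v, ν⟩` with `v_ν + 1 ≤ h`, lower coordinates transverse-zero ⟹ chord `≤ h·ρ`
  have hrail : ∀ (w : B7Prop1Explicit.Site P.d) (ν : Fin P.d), (∀ κ, (w κ).natAbs ≤ h) → w ν + 1 ≤ (h : ℤ) →
      (∀ ν', ν' < ν → ν' ≠ μ → w ν' = 0) → dist1 ((U ⟨transl (emb B) w, ν⟩)⁻¹ * W ⟨transl (emb B) w, ν⟩) ≤ h * ρ := by
    intro w ν hw hwν hz
    have h1 := dist1_chord_transl_le hj W U B htree hρ0 hρ ν _ w hw hwν rfl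
    have h2 : (∑ ν' ∈ Finset.univ.filter (fun ν' => ν' < ν), (w ν').natAbs) ≤ h := (sum_lower_le_of_transverse_zero w μ ν hz).trans (hw μ)
    have h3 : ((∑ ν' ∈ Finset.univ.filter (fun ν' => ν' < ν), (w ν').natAbs : ℕ) : ℝ) * ρ ≤ (h : ℝ) * ρ :=
      mul_le_mul_of_nonneg_right (by exact_mod_cast h2) hρ0
    exact h1.trans h3
  -- one RAIL in `B + e_μ`
  have hrail' : ∀ (w : B7Prop1Explicit.Site P.d) (ν : Fin P.d), (∀ κ, (w κ).natAbs ≤ h) → w ν + 1 ≤ (h : ℤ) →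
      (∀ ν', ν' < ν → ν' ≠ μ → w ν' = 0) →
        dist1 ((U ⟨transl (emb (B.shift μ)) w, ν⟩)⁻¹ * W ⟨transl (emb (B.shift μ)) w, ν⟩) ≤ h * ρ := by
    intro w ν hw hwν hz
    have h1 := dist1_chord_transl_le hj W U (B.shift μ) htree' hρ0 hρ' ν _ w hw hwν rfl
    have h2 : (∑ ν' ∈ Finset.univ.filter (fun ν' => ν' < ν), (w ν').natAbs) ≤ h := (sum_lower_le_of_transverse_zero w μ ν hz).trans (hw μ)
    have h3 : ((∑ ν' ∈ Finset.univ.filter (fun ν' => ν' < ν), (w ν').natAbs : ℕ) : ℝ) * ρ ≤ (h : ℝ) * ρ :=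
      mul_le_mul_of_nonneg_right (by exact_mod_cast h2) hρ0
    exact h1.trans h3
  intro n
  induction n with
  | zero =>
    intro v hv hvμ hsum
    -- all transverse coordinates vanish: `v` IS the face centre
    have hv0 : v = fun ν => if ν = μ then (h : ℤ) else 0 := by
      funext ν
      by_cases hν : ν = μ
      · rw [if_pos hν, hν, hvμ]
      · rw [if_neg hν]
        have := Finset.sum_eq_zero_iff.mp hsum ν (by simp only [Finset.mem_filter, Finset.mem_univ, true_and]; exact hν)
        exact Int.natAbs_eq_zero.mp this
    rw [hv0, Nat.cast_zero, zero_mul, add_zero]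
  | succ n ih =>
    intro v hv hvμ hsum
    -- a nonzero transverse coordinate exists; take the lowest
    set u : B7Prop1Explicit.Site P.d := fun ν => if ν = μ then 0 else v ν with hu
    have hex : ∃ ν, u ν ≠ 0 := by
      by_contra hnone
      have hzero : ∀ ν, ν ≠ μ → v ν = 0 := fun ν hν => by
        by_contra hvν
        exact hnone ⟨ν, by rw [hu]; dsimp only; rw [if_neg hν]; exact hvν⟩
      have : (∑ ν ∈ Finset.univ.filter (fun ν => ν ≠ μ), (v ν).natAbs) = 0 :=
        Finset.sum_eq_zero (fun ν hν => by
          simp only [Finset.mem_filter, Finset.mem_univ, true_and] at hν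
          rw [hzero ν hν, Int.natAbs_zero])
      omega
    obtain ⟨ν, hνu, hlo⟩ := exists_min_dir' u hex
    have hνμ : ν ≠ μ := fun hh' => hνu (by rw [hu]; exact if_pos hh')
    have hμν : μ ≠ ν := fun hh' => hνμ hh'.symm
    have hvν : v ν ≠ 0 := by rw [hu] at hνu; dsimp only at hνu; rw [if_neg hνμ] at hνu; exact hνu
    have hloz : ∀ ν', ν' < ν → ν' ≠ μ → v ν' = 0 := fun ν' hν' hne => by
      have := hlo ν' hν'; rw [hu] at this; dsimp only at this; rw [if_neg hne] at this; exact this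
    -- transverse sum of `v ± e_ν` is `n`
    have hsum' : ∀ (v' : B7Prop1Explicit.Site P.d), (∀ κ, κ ≠ ν → v' κ = v κ) → (v' ν).natAbs + 1 = (v ν).natAbs →
        (∑ κ ∈ Finset.univ.filter (fun κ => κ ≠ μ), (v' κ).natAbs) = n := by
      intro v' hv' hv'ν
      have hνmem : ν ∈ Finset.univ.filter (fun κ => κ ≠ μ) := by
        simp only [Finset.mem_filter, Finset.mem_univ, true_and]; exact hνμ
      have hsplit := Finset.add_sum_erase _ (fun κ => (v κ).natAbs) hνmem
      have hsplit' := Finset.add_sum_erase _ (fun κ => (v' κ).natAbs) hνmem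
      have hrest : (∑ κ ∈ (Finset.univ.filter (fun κ => κ ≠ μ)).erase ν, (v' κ).natAbs) =
          ∑ κ ∈ (Finset.univ.filter (fun κ => κ ≠ μ)).erase ν, (v κ).natAbs :=
        Finset.sum_congr rfl (fun κ hκ => by rw [hv' κ (Finset.ne_of_mem_erase hκ)])
      omega
    set y := transl (emb B) v with hy
    have hyB : blockOf y = B := hin v hv
    rcases lt_or_gt_of_ne hvν with hneg | hpos
    · -- NEGATIVE transverse coordinate: the square at `y` read backwards; far rung at `y + e_ν`
      set v' := v + e ν with hv'
      have hv'c : ∀ κ, κ ≠ ν → v' κ = v κ := fun κ hκ => by rw [hv', coord_add_e, if_neg hκ, add_zero]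
      have hv'b : ∀ κ, (v' κ).natAbs ≤ h := by
        intro κ
        by_cases hκ : κ = ν
        · subst hκ; rw [hv', coord_add_e, if_pos rfl]
          have := hv κ
          rcases Int.natAbs_eq (v κ) with hh' | hh' <;> rcases Int.natAbs_eq (v κ + 1) with hh'' | hh'' <;> omega
        · rw [hv'c κ hκ]; exact hv κ
      have hv'μ : v' μ = (h : ℤ) := by rw [hv'c μ hμν]; exact hvμ
      have hv'ν : (v' ν).natAbs + 1 = (v ν).natAbs := by
        rw [hv', coord_add_e, if_pos rfl]
        rcases Int.natAbs_eq (v ν) with hh' | hh' <;> rcases Int.natAbs_eq (v ν + 1) with hh'' | hh'' <;> omega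
      have hIH := ih v' hv'b hv'μ (hsum' v' hv'c hv'ν)
      have hfarEq : y.shift ν = transl (emb B) v' := by rw [hy, hshift]
      -- rails
      have hbot : dist1 ((U ⟨y, ν⟩)⁻¹ * W ⟨y, ν⟩) ≤ h * ρ :=
        hrail v ν hv (by omega) hloz
      have htop : dist1 ((U ⟨y.shift μ, ν⟩)⁻¹ * W ⟨y.shift μ, ν⟩) ≤ h * ρ := by
        rw [hy, hshift, hfar v hvμ]
        refine hrail' _ ν (hfarb v hv hvμ) ?_ (fun ν' hν' hne => ?_)
        · rw [Pi.sub_apply, coord_add_e, if_neg hνμ, add_zero, Pi.smul_apply, e_apply, if_neg hνμ, smul_eq_mul, mul_zero, sub_zero]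
          omega
        · rw [Pi.sub_apply, coord_add_e, if_neg hne, add_zero, Pi.smul_apply, e_apply, if_neg hne, smul_eq_mul, mul_zero, sub_zero]
          exact hloz ν' hν' hne
      -- the backward step
      have hstep := dist1_nearRung_rel_le W U y ν μ
      have hsq := dist1_square_rel_le W U hρ0 y (fun q hq => hρ q (by rw [hq]; exact hyB)) ν μ
      rw [dist1_mul_inv_eq_rel] at hsq
      have hrailterm : dist1 ((W ⟨y.shift μ, ν⟩)⁻¹ * U ⟨y.shift μ, ν⟩ *
          ((U ⟨y.shift ν, μ⟩)⁻¹ * ((U ⟨y, ν⟩)⁻¹ * W ⟨y, ν⟩) * U ⟨y.shift ν, μ⟩)) ≤ h * ρ + h * ρ := by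
        refine (dist1_mul_conj_le' _ _ _).trans (add_le_add ?_ hbot)
        rw [dist1_inv_mul_eq_dist1_inv_mul]; exact htop
      rw [hfarEq] at hstep hrailterm hsq
      have hIH' := hIH
      calc dist1 ((U ⟨y, μ⟩)⁻¹ * W ⟨y, μ⟩)
          ≤ _ := hstep
        _ ≤ ρ + (dist1 ((U ⟨transl (emb B) (fun ν => if ν = μ then (h : ℤ) else 0), μ⟩)⁻¹ *
              W ⟨transl (emb B) (fun ν => if ν = μ then (h : ℤ) else 0), μ⟩) + n * ((1 + 2 * (h : ℝ)) * ρ)) + (h * ρ + h * ρ) :=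
            add_le_add (add_le_add hsq hIH') hrailterm
        _ = _ := by push_cast; ring
    · -- POSITIVE transverse coordinate: the square at `y' = y − e_ν` read forwards; far rung = `⟨y, μ⟩`
      set v' := v - e ν with hv'
      have hv'c : ∀ κ, κ ≠ ν → v' κ = v κ := fun κ hκ => by rw [hv', coord_sub_e, if_neg hκ, sub_zero]
      have hv'b : ∀ κ, (v' κ).natAbs ≤ h := by
        intro κ
        by_cases hκ : κ = ν
        · subst hκ; rw [hv', coord_sub_e, if_pos rfl]
          have := hv κ
          rcases Int.natAbs_eq (v κ) with hh' | hh' <;> rcases Int.natAbs_eq (v κ - 1) with hh'' | hh'' <;> omega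
        · rw [hv'c κ hκ]; exact hv κ
      have hv'μ : v' μ = (h : ℤ) := by rw [hv'c μ hμν]; exact hvμ
      have hv'ν : (v' ν).natAbs + 1 = (v ν).natAbs := by
        rw [hv', coord_sub_e, if_pos rfl]
        rcases Int.natAbs_eq (v ν) with hh' | hh' <;> rcases Int.natAbs_eq (v ν - 1) with hh'' | hh'' <;> omega
      have hIH := ih v' hv'b hv'μ (hsum' v' hv'c hv'ν)
      set y' := transl (emb B) v' with hy'
      have hy'B : blockOf y' = B := hin v' hv'b
      have hfarEq : y'.shift ν = y := by
        rw [hy', hshift, hy]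
        have : v' + e ν = v := by rw [hv']; abel
        rw [this]
      have hloz' : ∀ ν', ν' < ν → ν' ≠ μ → v' ν' = 0 := fun ν' hν' hne => by rw [hv'c ν' (ne_of_lt hν')]; exact hloz ν' hν' hne
      -- rails
      have hbot : dist1 ((U ⟨y', ν⟩)⁻¹ * W ⟨y', ν⟩) ≤ h * ρ :=
        hrail v' ν hv'b (by rw [hv', coord_sub_e, if_pos rfl]; have := hv ν; rcases Int.natAbs_eq (v ν) with hh' | hh' <;> omega) hloz'
      have htop : dist1 ((U ⟨y'.shift μ, ν⟩)⁻¹ * W ⟨y'.shift μ, ν⟩) ≤ h * ρ := by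
        rw [hy', hshift, hfar v' hv'μ]
        refine hrail' _ ν (hfarb v' hv'b hv'μ) ?_ (fun ν' hν' hne => ?_)
        · rw [Pi.sub_apply, coord_add_e, if_neg hνμ, add_zero, Pi.smul_apply, e_apply, if_neg hνμ, smul_eq_mul, mul_zero, sub_zero,
            hv', coord_sub_e, if_pos rfl]
          have := hv ν; rcases Int.natAbs_eq (v ν) with hh' | hh' <;> omega
        · rw [Pi.sub_apply, coord_add_e, if_neg hne, add_zero, Pi.smul_apply, e_apply, if_neg hne, smul_eq_mul, mul_zero, sub_zero]
          exact hloz' ν' hν' hne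
      have hstep := dist1_farRung_rel_le W U y' ν μ
      have hsq := dist1_square_rel_le W U hρ0 y' (fun q hq => hρ q (by rw [hq]; exact hy'B)) ν μ
      rw [dist1_mul_inv_eq_rel] at hsq
      have hrailterm : dist1 (W ⟨y'.shift μ, ν⟩ * (U ⟨y'.shift μ, ν⟩)⁻¹ *
          ((U ⟨y', ν⟩ * U ⟨y'.shift ν, μ⟩ * (U ⟨y'.shift μ, ν⟩)⁻¹ * (U ⟨y', μ⟩)⁻¹ * U ⟨y', μ⟩)⁻¹ * (U ⟨y', ν⟩ * (W ⟨y', ν⟩)⁻¹) *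
            (U ⟨y', ν⟩ * U ⟨y'.shift ν, μ⟩ * (U ⟨y'.shift μ, ν⟩)⁻¹ * (U ⟨y', μ⟩)⁻¹ * U ⟨y', μ⟩))) ≤ h * ρ + h * ρ := by
        refine (dist1_mul_conj_le' _ _ _).trans (add_le_add ?_ ?_)
        · rw [dist1_mul_inv_eq_rel]; exact htop
        · rw [dist1_mul_inv_eq_rel, dist1_inv_mul_eq_dist1_inv_mul]; exact hbot
      rw [hfarEq] at hstep hsq hrailterm
      calc dist1 ((U ⟨y, μ⟩)⁻¹ * W ⟨y, μ⟩)
          ≤ _ := hstep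
        _ ≤ ρ + (dist1 ((U ⟨transl (emb B) (fun ν => if ν = μ then (h : ℤ) else 0), μ⟩)⁻¹ *
              W ⟨transl (emb B) (fun ν => if ν = μ then (h : ℤ) else 0), μ⟩) + n * ((1 + 2 * (h : ℝ)) * ρ)) + (h * ρ + h * ρ) :=
            add_le_add (add_le_add hsq hIH) hrailterm
        _ = _ := by push_cast; ring

/-- ★★★ **THE FACE LADDER, BLOCK FORM.**  For a site `x ∈ B` on the `μ`-face layer (`(x − emb B)_μ = (L−1)∕2`):
`dist1 (U⟨x,μ⟩⁻¹·W⟨x,μ⟩) ≤ dist1 (U⟨x₀,μ⟩⁻¹·W⟨x₀,μ⟩) + (Σ_{ν≠μ}|(x − emb B)_ν|)·(1 + 2·((L−1)∕2))·ρ`, `x₀ = emb B + ((L−1)∕2)·e_μ` the face centre; with `Σ_{ν≠μ}|…| ≤ (d−1)·((L−1)∕2)`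
this is «central + (d−1)·((L−1)∕2)·L·ρ». [cite: Balaban1989LargeFieldII, p.382; Balaban1987RG1, (0.3)-(0.4) p.252] -/
theorem dist1_faceChord_le_central_add (hj : j + 1 ≤ P.m + P.K) (W U : GaugeField P j G) (B : Site P (j + 1)) (μ : Fin P.d)
    (htree : ∀ (x : Site P j) (κ : Fin P.d), blockOf x = B → blockOf (x.shift κ) = B → (∀ ν, ν < κ → rel (emb B) x ν = 0) → W ⟨x, κ⟩ = U ⟨x, κ⟩)
    (htree' : ∀ (x : Site P j) (κ : Fin P.d), blockOf x = B.shift μ → blockOf (x.shift κ) = B.shift μ →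
      (∀ ν, ν < κ → rel (emb (B.shift μ)) x ν = 0) → W ⟨x, κ⟩ = U ⟨x, κ⟩)
    {ρ : ℝ} (hρ0 : 0 ≤ ρ) (hρ : ∀ q : Plaq P j, blockOf q.src = B → dist1 ((GaugeField.plaqHol U q)⁻¹ * GaugeField.plaqHol W q) ≤ ρ)
    (hρ' : ∀ q : Plaq P j, blockOf q.src = B.shift μ → dist1 ((GaugeField.plaqHol U q)⁻¹ * GaugeField.plaqHol W q) ≤ ρ)
    (x : Site P j) (hx : blockOf x = B) (hface : rel (emb B) x μ = (((P.L - 1) / 2 : ℕ) : ℤ)) :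
    dist1 ((U ⟨x, μ⟩)⁻¹ * W ⟨x, μ⟩) ≤
      dist1 ((U ⟨transl (emb B) (fun ν => if ν = μ then (((P.L - 1) / 2 : ℕ) : ℤ) else 0), μ⟩)⁻¹ *
          W ⟨transl (emb B) (fun ν => if ν = μ then (((P.L - 1) / 2 : ℕ) : ℤ) else 0), μ⟩) +
        (∑ ν ∈ Finset.univ.filter (fun ν => ν ≠ μ), (rel (emb B) x ν).natAbs) * ((1 + 2 * (((P.L - 1) / 2 : ℕ) : ℝ)) * ρ) := by
  set v := rel (emb B) x with hv
  have hxv : x = transl (emb B) v := by rw [hv, transl_rel]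
  have hvb : ∀ ν, (v ν).natAbs ≤ (P.L - 1) / 2 :=
    fun ν => FluctuationComparisonRegPrIntLS2BetaIterAxialGaugeOneLevel.natAbs_rel_emb_le hj hx ν
  have hmain := dist1_faceChord_transl_le hj W U B μ htree htree' hρ0 hρ hρ' _ v hvb hface rfl
  rw [← hxv] at hmain
  exact_mod_cast hmain

end Summit.QuantumFields.YangMills.Theorems.FluctuationComparisonRegPrIntLS2BetaFaceLadderDiscrepancy
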